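import Summits.BirchSwinnertonDyer.BirchSwinnertonDyer.Theorems.KatoDescentTamePotSupersingularTameUpperFukudaQPRecords03
import Summits.BirchSwinnertonDyer.BirchSwinnertonDyer.Theorems.KatoDescentTamePotSupersingularCartanMuRoadQuadraticUpperDoors
import HarnessLib

/-!
# Route `KatoDescentTamePotSupersingular` (rung K8, sub-rung B4 (t′), cell `bsd-potss`): the KT rows of `KatoDescentTamePotSupersingularTameUpperFukudaQPRecordsNoGrowth03`
# RE-RECORDED with NO NAMED FACT for statement (A) — Ferrero–Washington REMOVED — and U₀ `MissingUpperBoundAt E 3` modulo `hKatoA hGZK hmod` ONLY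
# (seat `bsd-potss-k8t-c4` g23; `--supports stmt-BirchSwinnertonDyer-19982 --as helper`; closes nothing)

HONEST FRAMING. Route-free THEOREMS ONLY (no definition, no named fact, no `sorry`); PER ROW — NOT a class theorem; nothing is booked; items 19202 /
19982 / 19916 stay OPEN at class level (class-wide open inputs unchanged: the zeta crux 24439 and the lower half of the residual 19984); (A), Conjecture A
and BSD are proved for NO curve as a class. WHAT CHANGED (g23): the g22 records `…_noGrowth` displayed ONE named fact for (A), Ferrero–Washington
(`hFW`), consumed on the biquadratic subfield `ℚ(√−3, √d)` of `ℚ(E[3])` and on a quadratic field inside `ℚ(P)`. By the character count of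
`Literature/…/IwasawaTheory/ClassicalMuVanishesCartanQuadraticDescent` + `…CartanImageThreeQuadratic` (g23: on `Gal(ℚ(E[3])/ℚ) ≅ SD₁₆` every
irreducible character occurs in `Ind_⟨c⟩ 1 = ℚ(P)` except the two linear ones with `χ(c) = −1`, whose fields are the IMAGINARY QUADRATIC subfields)
`hFW` is replaced by the displayed datum `hqrk`: «for every quadratic `K ⊆ ℚ(E[3])` NOT fixed by the complex conjugation `c` and every cyclotomic
`ℤ₃`-extension of `K`, `rank₃ Cl(K₁) = rank₃ Cl(K₀)`» — Fukuda 1994 Thm. 1 (2), a tree theorem. NUMERICS (kit j326341: `nfsubfields` of the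
splitting field of `ψ₃`; kit j326712: `bnfinit` + `bnfcertify` = 1 at degrees 2 and 6, GRH-free): on every row below `ℚ(E[3])` has exactly three
quadratic subfields `ℚ(√−3)`, `ℚ(√D)` (`D < 0`), `ℚ(√(3·|D|))` (real, inside `ℚ(P)` up to the tower descent); the two imaginary ones satisfy `hqrk`:
`ℚ(√−3)`: `h = 1`, `K₁ = ℚ(ζ₉)` (`x^6 - x^3 + 1`), `h = 1`, `rank₃: 0 = 0`; `ℚ(√D)` as recorded per row. The `ℚ(P)` datum (`hord` / `hrk` / `hμ`),
Cremona's `r_an = 0` and the kernel certificates (`irr_…`, `hasModPImageEqNonsplitCartanNormalizer_…`, `addv_…`, `subTprime_…`) are those of the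
source records, REUSED. Doors: `CartanMuRoadQuadraticDoors` / `…QuadraticUpperDoors` (g23).
[cite: Fukuda1994, Thm. 1, p. 264] [cite: CoatesSujatha2005, Thm. 3.4 (§3)] [cite: Kato2004Asterisque, Thm. 14.5 (3) (p. 236)] [cite: Serre1972, §2.2, §5.2 (iv)]
[cite: Washington1997, §13.1, §13.3 Prop. 13.23] [cite: Cremona2006, Table 1]
-/

set_option autoImplicit false
set_option linter.dupNamespace false

noncomputable section

open scoped Classical NumberField
open Polynomial WeierstrassCurve NumberField Field IntermediateField
  Literature.NumberTheory.EllipticCurves Literature.NumberTheory.EllipticCurves.Rank1Residual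
  Literature.NumberTheory.EllipticCurves.Rank1Residual.Typed
  Literature.NumberTheory.GaloisRepresentations Literature.NumberTheory.SerreUniformity Literature.NumberTheory.IwasawaTheory
  Summit.BirchSwinnertonDyer.Rank1Residual Summit.BirchSwinnertonDyer.Rank1Residual.Additive
  Summit.BirchSwinnertonDyer.BirchSwinnertonDyer.Theorems

namespace Summit.BirchSwinnertonDyer.BirchSwinnertonDyer.Theorems.TameUpperUnitTwistRecords

/-- **(A) at `(207936eb1, 3)` from `ord₃ h(ℚ(P)₁) = ord₃ h(ℚ(P)₀)` and `rank₃ Cl(K₁) = rank₃ Cl(K₀)` on the two imaginary quadratic subfields — NO NAMED FACT** (Coates–Sujatha 3.4,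
Fukuda Thm. 1 PROVED; Ferrero–Washington REMOVED; door `CartanMuRoadQuadraticDoors`; kernel certificates `irr_g207936eb1_3`, `hasModPImageEqNonsplitCartanNormalizer_g207936eb1_3` reused).
DISPLAYED: quadratic subfields of `ℚ(E[3])` (kit j326341): `ℚ(√−3)`, `ℚ(√-19)`, `ℚ(√57)` (real); the imaginary pair certified for `hqrk` (kit j326712): `ℚ(√-3)`: `h = 1` (`Cl ≅ []`), layer 1 `K₁ = ℚ(√-3)·ℚ(ζ₉)⁺` = `x^6 - x^3 + 1`, `h(K₁) = 1` (`Cl ≅ []`), `rank₃`: `0 = 0` — bnfcertify 1/1; `ℚ(√-19)`: `h = 1` (`Cl ≅ []`), layer 1 `K₁ = ℚ(√-19)·ℚ(ζ₉)⁺` = `x^6 - 3*x^5 + 12*x^4 - 17*x^3 + 87*x^2 - 114*x + 323`, `h(K₁) = 4` (`Cl ≅ [2, 2]`), `rank₃`: `0 = 0` — bnfcertify 1/1. Per row; (A) is now a consequence of displayed integers ALONE.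
[cite: Fukuda1994, Thm. 1, p. 264] [cite: CoatesSujatha2005, Thm. 3.4 (§3)] [cite: Washington1997, §13.1, §13.3 Prop. 13.23] [cite: Cremona2006, Table 1 (Cremona label 207936eb1)] -/
theorem conjA_g207936eb1_3_quad
    {W : WeierstrassCurve ℚ} [W.IsElliptic] (hWeq : W = (⟨0, 0, 0, (-9804), (-363888)⟩ : WeierstrassCurve ℚ))
    {c : absoluteGaloisGroup ℚ} (hc : IsComplexConjugation (Rat.castHom ℝ) c)
    (hord : ∀ κE : ZpExtension ↥(fixedField (Subgroup.zpowers (absRestrictNormalHom (W.divisionField 3) c))) 3,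
      κE.IsCyclotomic → classNumberPExp κE (0 + 1) = classNumberPExp κE 0)
    (hqrk : haveI : NumberField ↥(W.divisionField 3) := NumberField.mk
      ∀ K : IntermediateField ℚ ↥(W.divisionField 3), Module.finrank ℚ ↥K = 2 →
        ¬ K ≤ fixedField (Subgroup.zpowers (absRestrictNormalHom (W.divisionField 3) c)) →
        ∀ κE : ZpExtension ↥K 3, κE.IsCyclotomic → classGroupPRank κE (0 + 1) = classGroupPRank κE 0)
    (κ : ZpExtension ℚ 3) (hκ : κ.IsCyclotomic) :
    ∃ (γ : absoluteGaloisGroup ℚ) (Df : W.FineSelmerDualData κ γ),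
      Module.Finite ℤ_[3] (RestrictScalars ℤ_[3] (IwasawaAlgebra 3) Df.X) := by
  subst hWeq
  exact CartanMuRoadQuadraticDoors.conjA_three_of_hasModPImageEqNonsplitCartanNormalizer_of_realSuccEqAt_of_quadRankSuccEqAt _
    irr_g207936eb1_3 hasModPImageEqNonsplitCartanNormalizer_g207936eb1_3 hc 0 hord 0 hqrk κ hκ

/-- **RECORD — UPPER half `ord₃ #Ш(E) ≤ ord₃ #Ш(E)_an` for `E = 207936eb1` at `p = 3` from `ord₃ h(ℚ(P)₁) = ord₃ h(ℚ(P)₀)` and the imaginary-quadratic rank datum `hqrk`, modulo `hKatoA hGZK hmod` ONLY**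
(Ferrero–Washington REMOVED; kernel certificates `irr_…`, `addv_…`, `subTprime_…`, `hasModPImageEqNonsplitCartanNormalizer_…` reused; Cremona's `r_an = 0` displayed).
DISPLAYED: quadratic subfields of `ℚ(E[3])` (kit j326341): `ℚ(√−3)`, `ℚ(√-19)`, `ℚ(√57)` (real); the imaginary pair certified for `hqrk` (kit j326712): `ℚ(√-3)`: `h = 1` (`Cl ≅ []`), layer 1 `K₁ = ℚ(√-3)·ℚ(ζ₉)⁺` = `x^6 - x^3 + 1`, `h(K₁) = 1` (`Cl ≅ []`), `rank₃`: `0 = 0` — bnfcertify 1/1; `ℚ(√-19)`: `h = 1` (`Cl ≅ []`), layer 1 `K₁ = ℚ(√-19)·ℚ(ζ₉)⁺` = `x^6 - 3*x^5 + 12*x^4 - 17*x^3 + 87*x^2 - 114*x + 323`, `h(K₁) = 4` (`Cl ≅ [2, 2]`), `rank₃`: `0 = 0` — bnfcertify 1/1. Per row; nothing booked; BSD is not proved by this. [cite: Kato2004Asterisque, Thm. 14.5 (3) (p. 236)] [cite: Fukuda1994, Thm. 1, p. 264]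
[cite: CoatesSujatha2005, Thm. 3.4 (§3)] [cite: Cremona2006, Table 1 (Cremona label 207936eb1)] -/
theorem missingUpperBoundAt_g207936eb1_3_quad
    (hKatoA : Kato2004.rankZero_padicValNat_sha_add_padicValNat_tamagawa_le_of_additive_potGood_of_irreducible_of_fineSelmerDual_fg)
    (hGZK : rank_eq_analyticRank_of_analyticRank_le_one) (hmod : hasEntireLFunction_rat)
    {W : WeierstrassCurve ℚ} [W.IsElliptic] [W.IsGloballyMinimal] (hWeq : W = (⟨0, 0, 0, (-9804), (-363888)⟩ : WeierstrassCurve ℚ))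
    (hr : W.analyticRank = 0) {c : absoluteGaloisGroup ℚ} (hc : IsComplexConjugation (Rat.castHom ℝ) c)
    (hord : ∀ κE : ZpExtension ↥(fixedField (Subgroup.zpowers (absRestrictNormalHom (W.divisionField 3) c))) 3,
      κE.IsCyclotomic → classNumberPExp κE (0 + 1) = classNumberPExp κE 0)
    (hqrk : haveI : NumberField ↥(W.divisionField 3) := NumberField.mk
      ∀ K : IntermediateField ℚ ↥(W.divisionField 3), Module.finrank ℚ ↥K = 2 →
        ¬ K ≤ fixedField (Subgroup.zpowers (absRestrictNormalHom (W.divisionField 3) c)) →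
        ∀ κE : ZpExtension ↥K 3, κE.IsCyclotomic → classGroupPRank κE (0 + 1) = classGroupPRank κE 0) :
    MissingUpperBoundAt W 3 := by
  subst hWeq
  haveI : Fact (Nat.Prime 3) := ⟨Nat.prime_three⟩
  exact CartanMuRoadQuadraticDoors.missingUpperBoundAt_three_tame_of_hasModPImageEqNonsplitCartanNormalizer_of_realSuccEqAt_of_quadRankSuccEqAt _
    hKatoA hGZK hmod hr addv_g207936eb1_3 subTprime_g207936eb1_3 irr_g207936eb1_3
    hasModPImageEqNonsplitCartanNormalizer_g207936eb1_3 hc 0 hord 0 hqrk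

/-- **(A) at `(207936ec1, 3)` from `ord₃ h(ℚ(P)₁) = ord₃ h(ℚ(P)₀)` and `rank₃ Cl(K₁) = rank₃ Cl(K₀)` on the two imaginary quadratic subfields — NO NAMED FACT** (Coates–Sujatha 3.4,
Fukuda Thm. 1 PROVED; Ferrero–Washington REMOVED; door `CartanMuRoadQuadraticDoors`; kernel certificates `irr_g207936ec1_3`, `hasModPImageEqNonsplitCartanNormalizer_g207936ec1_3` reused).
DISPLAYED: quadratic subfields of `ℚ(E[3])` (kit j326341): `ℚ(√−3)`, `ℚ(√-19)`, `ℚ(√57)` (real); the imaginary pair certified for `hqrk` (kit j326712): `ℚ(√-3)`: `h = 1` (`Cl ≅ []`), layer 1 `K₁ = ℚ(√-3)·ℚ(ζ₉)⁺` = `x^6 - x^3 + 1`, `h(K₁) = 1` (`Cl ≅ []`), `rank₃`: `0 = 0` — bnfcertify 1/1; `ℚ(√-19)`: `h = 1` (`Cl ≅ []`), layer 1 `K₁ = ℚ(√-19)·ℚ(ζ₉)⁺` = `x^6 - 3*x^5 + 12*x^4 - 17*x^3 + 87*x^2 - 114*x + 323`, `h(K₁) = 4` (`Cl ≅ [2,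 2]`), `rank₃`: `0 = 0` — bnfcertify 1/1. Per row; (A) is now a consequence of displayed integers ALONE.
[cite: Fukuda1994, Thm. 1, p. 264] [cite: CoatesSujatha2005, Thm. 3.4 (§3)] [cite: Washington1997, §13.1, §13.3 Prop. 13.23] [cite: Cremona2006, Table 1 (Cremona label 207936ec1)] -/
theorem conjA_g207936ec1_3_quad
    {W : WeierstrassCurve ℚ} [W.IsElliptic] (hWeq : W = (⟨0, 0, 0, (-3539244), 2495907792⟩ : WeierstrassCurve ℚ))
    {c : absoluteGaloisGroup ℚ} (hc : IsComplexConjugation (Rat.castHom ℝ) c)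
    (hord : ∀ κE : ZpExtension ↥(fixedField (Subgroup.zpowers (absRestrictNormalHom (W.divisionField 3) c))) 3,
      κE.IsCyclotomic → classNumberPExp κE (0 + 1) = classNumberPExp κE 0)
    (hqrk : haveI : NumberField ↥(W.divisionField 3) := NumberField.mk
      ∀ K : IntermediateField ℚ ↥(W.divisionField 3), Module.finrank ℚ ↥K = 2 →
        ¬ K ≤ fixedField (Subgroup.zpowers (absRestrictNormalHom (W.divisionField 3) c)) →
        ∀ κE : ZpExtension ↥K 3, κE.IsCyclotomic → classGroupPRank κE (0 + 1) = classGroupPRank κE 0)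
    (κ : ZpExtension ℚ 3) (hκ : κ.IsCyclotomic) :
    ∃ (γ : absoluteGaloisGroup ℚ) (Df : W.FineSelmerDualData κ γ),
      Module.Finite ℤ_[3] (RestrictScalars ℤ_[3] (IwasawaAlgebra 3) Df.X) := by
  subst hWeq
  exact CartanMuRoadQuadraticDoors.conjA_three_of_hasModPImageEqNonsplitCartanNormalizer_of_realSuccEqAt_of_quadRankSuccEqAt _
    irr_g207936ec1_3 hasModPImageEqNonsplitCartanNormalizer_g207936ec1_3 hc 0 hord 0 hqrk κ hκ

/-- **RECORD — UPPER half `ord₃ #Ш(E) ≤ ord₃ #Ш(E)_an` for `E = 207936ec1` at `p = 3` from `ord₃ h(ℚ(P)₁) = ord₃ h(ℚ(P)₀)` and the imaginary-quadratic rank datum `hqrk`, modulo `hKatoA hGZK hmod` ONLY**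
(Ferrero–Washington REMOVED; kernel certificates `irr_…`, `addv_…`, `subTprime_…`, `hasModPImageEqNonsplitCartanNormalizer_…` reused; Cremona's `r_an = 0` displayed).
DISPLAYED: quadratic subfields of `ℚ(E[3])` (kit j326341): `ℚ(√−3)`, `ℚ(√-19)`, `ℚ(√57)` (real); the imaginary pair certified for `hqrk` (kit j326712): `ℚ(√-3)`: `h = 1` (`Cl ≅ []`), layer 1 `K₁ = ℚ(√-3)·ℚ(ζ₉)⁺` = `x^6 - x^3 + 1`, `h(K₁) = 1` (`Cl ≅ []`), `rank₃`: `0 = 0` — bnfcertify 1/1; `ℚ(√-19)`: `h = 1` (`Cl ≅ []`), layer 1 `K₁ = ℚ(√-19)·ℚ(ζ₉)⁺` = `x^6 - 3*x^5 + 12*x^4 - 17*x^3 + 87*x^2 - 114*x + 323`, `h(K₁) = 4` (`Cl ≅ [2, 2]`), `rank₃`: `0 = 0` — bnfcertify 1/1. Per row; nothing booked; BSD is not proved by this. [cite: Kato2004Asterisque, Thm. 14.5 (3) (p. 236)] [cite: Fukuda1994, Thm. 1, p. 264]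
[cite: CoatesSujatha2005, Thm. 3.4 (§3)] [cite: Cremona2006, Table 1 (Cremona label 207936ec1)] -/
theorem missingUpperBoundAt_g207936ec1_3_quad
    (hKatoA : Kato2004.rankZero_padicValNat_sha_add_padicValNat_tamagawa_le_of_additive_potGood_of_irreducible_of_fineSelmerDual_fg)
    (hGZK : rank_eq_analyticRank_of_analyticRank_le_one) (hmod : hasEntireLFunction_rat)
    {W : WeierstrassCurve ℚ} [W.IsElliptic] [W.IsGloballyMinimal] (hWeq : W = (⟨0, 0, 0, (-3539244), 2495907792⟩ : WeierstrassCurve ℚ))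
    (hr : W.analyticRank = 0) {c : absoluteGaloisGroup ℚ} (hc : IsComplexConjugation (Rat.castHom ℝ) c)
    (hord : ∀ κE : ZpExtension ↥(fixedField (Subgroup.zpowers (absRestrictNormalHom (W.divisionField 3) c))) 3,
      κE.IsCyclotomic → classNumberPExp κE (0 + 1) = classNumberPExp κE 0)
    (hqrk : haveI : NumberField ↥(W.divisionField 3) := NumberField.mk
      ∀ K : IntermediateField ℚ ↥(W.divisionField 3), Module.finrank ℚ ↥K = 2 →
        ¬ K ≤ fixedField (Subgroup.zpowers (absRestrictNormalHom (W.divisionField 3) c)) →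
        ∀ κE : ZpExtension ↥K 3, κE.IsCyclotomic → classGroupPRank κE (0 + 1) = classGroupPRank κE 0) :
    MissingUpperBoundAt W 3 := by
  subst hWeq
  haveI : Fact (Nat.Prime 3) := ⟨Nat.prime_three⟩
  exact CartanMuRoadQuadraticDoors.missingUpperBoundAt_three_tame_of_hasModPImageEqNonsplitCartanNormalizer_of_realSuccEqAt_of_quadRankSuccEqAt _
    hKatoA hGZK hmod hr addv_g207936ec1_3 subTprime_g207936ec1_3 irr_g207936ec1_3
    hasModPImageEqNonsplitCartanNormalizer_g207936ec1_3 hc 0 hord 0 hqrk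

/-- **(A) at `(243360dg1, 3)` from `ord₃ h(ℚ(P)₁) = ord₃ h(ℚ(P)₀)` and `rank₃ Cl(K₁) = rank₃ Cl(K₀)` on the two imaginary quadratic subfields — NO NAMED FACT** (Coates–Sujatha 3.4,
Fukuda Thm. 1 PROVED; Ferrero–Washington REMOVED; door `CartanMuRoadQuadraticDoors`; kernel certificates `irr_g243360dg1_3`, `hasModPImageEqNonsplitCartanNormalizer_g243360dg1_3` reused).
DISPLAYED: quadratic subfields of `ℚ(E[3])` (kit j326341): `ℚ(√−3)`, `ℚ(√-52)`, `ℚ(√156)` (real); the imaginary pair certified for `hqrk` (kit j326712): `ℚ(√-3)`: `h = 1` (`Cl ≅ []`), layer 1 `K₁ = ℚ(√-3)·ℚ(ζ₉)⁺` = `x^6 - x^3 + 1`, `h(K₁) = 1` (`Cl ≅ []`), `rank₃`: `0 = 0` — bnfcertify 1/1; `ℚ(√-52)`: `h = 2` (`Cl ≅ [2]`), layer 1 `K₁ = ℚ(√-52)·ℚ(ζ₉)⁺` = `x^6 + 33*x^4 - 2*x^3 + 516*x^2 + 84*x + 3329`, `h(K₁) = 26` (`Cl ≅ [26]`), `rank₃`: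 `0 = 0` — bnfcertify 1/1. Per row; (A) is now a consequence of displayed integers ALONE.
[cite: Fukuda1994, Thm. 1, p. 264] [cite: CoatesSujatha2005, Thm. 3.4 (§3)] [cite: Washington1997, §13.1, §13.3 Prop. 13.23] [cite: Cremona2006, Table 1 (Cremona label 243360dg1)] -/
theorem conjA_g243360dg1_3_quad
    {W : WeierstrassCurve ℚ} [W.IsElliptic] (hWeq : W = (⟨0, 0, 0, (-517736232), 4534307344944⟩ : WeierstrassCurve ℚ))
    {c : absoluteGaloisGroup ℚ} (hc : IsComplexConjugation (Rat.castHom ℝ) c)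
    (hord : ∀ κE : ZpExtension ↥(fixedField (Subgroup.zpowers (absRestrictNormalHom (W.divisionField 3) c))) 3,
      κE.IsCyclotomic → classNumberPExp κE (0 + 1) = classNumberPExp κE 0)
    (hqrk : haveI : NumberField ↥(W.divisionField 3) := NumberField.mk
      ∀ K : IntermediateField ℚ ↥(W.divisionField 3), Module.finrank ℚ ↥K = 2 →
        ¬ K ≤ fixedField (Subgroup.zpowers (absRestrictNormalHom (W.divisionField 3) c)) →
        ∀ κE : ZpExtension ↥K 3, κE.IsCyclotomic → classGroupPRank κE (0 + 1) = classGroupPRank κE 0)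
    (κ : ZpExtension ℚ 3) (hκ : κ.IsCyclotomic) :
    ∃ (γ : absoluteGaloisGroup ℚ) (Df : W.FineSelmerDualData κ γ),
      Module.Finite ℤ_[3] (RestrictScalars ℤ_[3] (IwasawaAlgebra 3) Df.X) := by
  subst hWeq
  exact CartanMuRoadQuadraticDoors.conjA_three_of_hasModPImageEqNonsplitCartanNormalizer_of_realSuccEqAt_of_quadRankSuccEqAt _
    irr_g243360dg1_3 hasModPImageEqNonsplitCartanNormalizer_g243360dg1_3 hc 0 hord 0 hqrk κ hκ

/-- **RECORD — UPPER half `ord₃ #Ш(E) ≤ ord₃ #Ш(E)_an` for `E = 243360dg1` at `p = 3` from `ord₃ h(ℚ(P)₁) = ord₃ h(ℚ(P)₀)` and the imaginary-quadratic rank datum `hqrk`, modulo `hKatoA hGZK hmod` ONLY**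
(Ferrero–Washington REMOVED; kernel certificates `irr_…`, `addv_…`, `subTprime_…`, `hasModPImageEqNonsplitCartanNormalizer_…` reused; Cremona's `r_an = 0` displayed).
DISPLAYED: quadratic subfields of `ℚ(E[3])` (kit j326341): `ℚ(√−3)`, `ℚ(√-52)`, `ℚ(√156)` (real); the imaginary pair certified for `hqrk` (kit j326712): `ℚ(√-3)`: `h = 1` (`Cl ≅ []`), layer 1 `K₁ = ℚ(√-3)·ℚ(ζ₉)⁺` = `x^6 - x^3 + 1`, `h(K₁) = 1` (`Cl ≅ []`), `rank₃`: `0 = 0` — bnfcertify 1/1; `ℚ(√-52)`: `h = 2` (`Cl ≅ [2]`), layer 1 `K₁ = ℚ(√-52)·ℚ(ζ₉)⁺` = `x^6 + 33*x^4 - 2*x^3 + 516*x^2 + 84*x + 3329`, `h(K₁) = 26` (`Cl ≅ [26]`), `rank₃`: `0 = 0` — bnfcertify 1/1. Per row; nothing booked; BSD is not proved by this. [cite: Kato2004Asterisque, Thm. 14.5 (3) (p. 236)] [cite: Fukuda1994, Thm. 1, p. 264]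
[cite: CoatesSujatha2005, Thm. 3.4 (§3)] [cite: Cremona2006, Table 1 (Cremona label 243360dg1)] -/
theorem missingUpperBoundAt_g243360dg1_3_quad
    (hKatoA : Kato2004.rankZero_padicValNat_sha_add_padicValNat_tamagawa_le_of_additive_potGood_of_irreducible_of_fineSelmerDual_fg)
    (hGZK : rank_eq_analyticRank_of_analyticRank_le_one) (hmod : hasEntireLFunction_rat)
    {W : WeierstrassCurve ℚ} [W.IsElliptic] [W.IsGloballyMinimal] (hWeq : W = (⟨0, 0, 0, (-517736232), 4534307344944⟩ : WeierstrassCurve ℚ))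
    (hr : W.analyticRank = 0) {c : absoluteGaloisGroup ℚ} (hc : IsComplexConjugation (Rat.castHom ℝ) c)
    (hord : ∀ κE : ZpExtension ↥(fixedField (Subgroup.zpowers (absRestrictNormalHom (W.divisionField 3) c))) 3,
      κE.IsCyclotomic → classNumberPExp κE (0 + 1) = classNumberPExp κE 0)
    (hqrk : haveI : NumberField ↥(W.divisionField 3) := NumberField.mk
      ∀ K : IntermediateField ℚ ↥(W.divisionField 3), Module.finrank ℚ ↥K = 2 →
        ¬ K ≤ fixedField (Subgroup.zpowers (absRestrictNormalHom (W.divisionField 3) c)) →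
        ∀ κE : ZpExtension ↥K 3, κE.IsCyclotomic → classGroupPRank κE (0 + 1) = classGroupPRank κE 0) :
    MissingUpperBoundAt W 3 := by
  subst hWeq
  haveI : Fact (Nat.Prime 3) := ⟨Nat.prime_three⟩
  exact CartanMuRoadQuadraticDoors.missingUpperBoundAt_three_tame_of_hasModPImageEqNonsplitCartanNormalizer_of_realSuccEqAt_of_quadRankSuccEqAt _
    hKatoA hGZK hmod hr addv_g243360dg1_3 subTprime_g243360dg1_3 irr_g243360dg1_3
    hasModPImageEqNonsplitCartanNormalizer_g243360dg1_3 hc 0 hord 0 hqrk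

/-- **(A) at `(243360l1, 3)` from `ord₃ h(ℚ(P)₁) = ord₃ h(ℚ(P)₀)` and `rank₃ Cl(K₁) = rank₃ Cl(K₀)` on the two imaginary quadratic subfields — NO NAMED FACT** (Coates–Sujatha 3.4,
Fukuda Thm. 1 PROVED; Ferrero–Washington REMOVED; door `CartanMuRoadQuadraticDoors`; kernel certificates `irr_g243360l1_3`, `hasModPImageEqNonsplitCartanNormalizer_g243360l1_3` reused).
DISPLAYED: quadratic subfields of `ℚ(E[3])` (kit j326341): `ℚ(√−3)`, `ℚ(√-52)`, `ℚ(√156)` (real); the imaginary pair certified for `hqrk` (kit j326712): `ℚ(√-3)`: `h = 1` (`Cl ≅ []`), layer 1 `K₁ = ℚ(√-3)·ℚ(ζ₉)⁺` = `x^6 - x^3 + 1`, `h(K₁) = 1` (`Cl ≅ []`), `rank₃`: `0 = 0` — bnfcertify 1/1; `ℚ(√-52)`: `h = 2` (`Cl ≅ [2]`), layer 1 `K₁ = ℚ(√-52)·ℚ(ζ₉)⁺` = `x^6 + 33*x^4 - 2*x^3 + 516*x^2 + 84*x + 3329`, `h(K₁) = 26` (`Cl ≅ [26]`), `rank₃`: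 `0 = 0` — bnfcertify 1/1. Per row; (A) is now a consequence of displayed integers ALONE.
[cite: Fukuda1994, Thm. 1, p. 264] [cite: CoatesSujatha2005, Thm. 3.4 (§3)] [cite: Washington1997, §13.1, §13.3 Prop. 13.23] [cite: Cremona2006, Table 1 (Cremona label 243360l1)] -/
theorem conjA_g243360l1_3_quad
    {W : WeierstrassCurve ℚ} [W.IsElliptic] (hWeq : W = (⟨0, 0, 0, (-57526248), (-167937309072)⟩ : WeierstrassCurve ℚ))
    {c : absoluteGaloisGroup ℚ} (hc : IsComplexConjugation (Rat.castHom ℝ) c)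
    (hord : ∀ κE : ZpExtension ↥(fixedField (Subgroup.zpowers (absRestrictNormalHom (W.divisionField 3) c))) 3,
      κE.IsCyclotomic → classNumberPExp κE (0 + 1) = classNumberPExp κE 0)
    (hqrk : haveI : NumberField ↥(W.divisionField 3) := NumberField.mk
      ∀ K : IntermediateField ℚ ↥(W.divisionField 3), Module.finrank ℚ ↥K = 2 →
        ¬ K ≤ fixedField (Subgroup.zpowers (absRestrictNormalHom (W.divisionField 3) c)) →
        ∀ κE : ZpExtension ↥K 3, κE.IsCyclotomic → classGroupPRank κE (0 + 1) = classGroupPRank κE 0)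
    (κ : ZpExtension ℚ 3) (hκ : κ.IsCyclotomic) :
    ∃ (γ : absoluteGaloisGroup ℚ) (Df : W.FineSelmerDualData κ γ),
      Module.Finite ℤ_[3] (RestrictScalars ℤ_[3] (IwasawaAlgebra 3) Df.X) := by
  subst hWeq
  exact CartanMuRoadQuadraticDoors.conjA_three_of_hasModPImageEqNonsplitCartanNormalizer_of_realSuccEqAt_of_quadRankSuccEqAt _
    irr_g243360l1_3 hasModPImageEqNonsplitCartanNormalizer_g243360l1_3 hc 0 hord 0 hqrk κ hκ

/-- **RECORD — UPPER half `ord₃ #Ш(E) ≤ ord₃ #Ш(E)_an` for `E = 243360l1` at `p = 3` from `ord₃ h(ℚ(P)₁) = ord₃ h(ℚ(P)₀)` and the imaginary-quadratic rank datum `hqrk`, modulo `hKatoA hGZK hmod` ONLY**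
(Ferrero–Washington REMOVED; kernel certificates `irr_…`, `addv_…`, `subTprime_…`, `hasModPImageEqNonsplitCartanNormalizer_…` reused; Cremona's `r_an = 0` displayed).
DISPLAYED: quadratic subfields of `ℚ(E[3])` (kit j326341): `ℚ(√−3)`, `ℚ(√-52)`, `ℚ(√156)` (real); the imaginary pair certified for `hqrk` (kit j326712): `ℚ(√-3)`: `h = 1` (`Cl ≅ []`), layer 1 `K₁ = ℚ(√-3)·ℚ(ζ₉)⁺` = `x^6 - x^3 + 1`, `h(K₁) = 1` (`Cl ≅ []`), `rank₃`: `0 = 0` — bnfcertify 1/1; `ℚ(√-52)`: `h = 2` (`Cl ≅ [2]`), layer 1 `K₁ = ℚ(√-52)·ℚ(ζ₉)⁺` = `x^6 + 33*x^4 - 2*x^3 + 516*x^2 + 84*x + 3329`, `h(K₁) = 26` (`Cl ≅ [26]`), `rank₃`: `0 = 0` — bnfcertify 1/1. Per row; nothing booked; BSD is not proved by this. [cite: Kato2004Asterisque, Thm. 14.5 (3) (p. 236)] [cite: Fukuda1994, Thm. 1, p. 264]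
[cite: CoatesSujatha2005, Thm. 3.4 (§3)] [cite: Cremona2006, Table 1 (Cremona label 243360l1)] -/
theorem missingUpperBoundAt_g243360l1_3_quad
    (hKatoA : Kato2004.rankZero_padicValNat_sha_add_padicValNat_tamagawa_le_of_additive_potGood_of_irreducible_of_fineSelmerDual_fg)
    (hGZK : rank_eq_analyticRank_of_analyticRank_le_one) (hmod : hasEntireLFunction_rat)
    {W : WeierstrassCurve ℚ} [W.IsElliptic] [W.IsGloballyMinimal] (hWeq : W = (⟨0, 0, 0, (-57526248), (-167937309072)⟩ : WeierstrassCurve ℚ))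
    (hr : W.analyticRank = 0) {c : absoluteGaloisGroup ℚ} (hc : IsComplexConjugation (Rat.castHom ℝ) c)
    (hord : ∀ κE : ZpExtension ↥(fixedField (Subgroup.zpowers (absRestrictNormalHom (W.divisionField 3) c))) 3,
      κE.IsCyclotomic → classNumberPExp κE (0 + 1) = classNumberPExp κE 0)
    (hqrk : haveI : NumberField ↥(W.divisionField 3) := NumberField.mk
      ∀ K : IntermediateField ℚ ↥(W.divisionField 3), Module.finrank ℚ ↥K = 2 →
        ¬ K ≤ fixedField (Subgroup.zpowers (absRestrictNormalHom (W.divisionField 3) c)) →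
        ∀ κE : ZpExtension ↥K 3, κE.IsCyclotomic → classGroupPRank κE (0 + 1) = classGroupPRank κE 0) :
    MissingUpperBoundAt W 3 := by
  subst hWeq
  haveI : Fact (Nat.Prime 3) := ⟨Nat.prime_three⟩
  exact CartanMuRoadQuadraticDoors.missingUpperBoundAt_three_tame_of_hasModPImageEqNonsplitCartanNormalizer_of_realSuccEqAt_of_quadRankSuccEqAt _
    hKatoA hGZK hmod hr addv_g243360l1_3 subTprime_g243360l1_3 irr_g243360l1_3
    hasModPImageEqNonsplitCartanNormalizer_g243360l1_3 hc 0 hord 0 hqrk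

end Summit.BirchSwinnertonDyer.BirchSwinnertonDyer.Theorems.TameUpperUnitTwistRecords

end
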